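import Summits.ResolutionOfSingularities.ResolutionOfSingularities.Theorems.FrobeniusClosingSteerSteeredMembersRegular
import Summits.ResolutionOfSingularities.ResolutionOfSingularities.Theorems.FrobeniusClosingSteerEmptyStallTwo
import Literature.AlgebraicGeometry.Resolution.ValuedFunctionFields
import Literature.AlgebraicGeometry.Resolution.QuadraticTransforms
import Literature.AlgebraicGeometry.Resolution.RsopMonomialIdeals
import HarnessLib

/-!
# Crux `Steer` (stmt-ResolutionOfSingularities-16345), chain W4.1, σ_top line at `p = 2`: pieces **M
# `SteeredMembersRegular`** and **B₂ `EmptyStallTwo`**, LITERALLY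

OURS (campaign `res-hironaka`, rung L, slot W4.1, unit `res-L0-w41-stub-2` g3; replaces the role of no
printed item; NOT a statement of the manuscript under review; AI-produced, weaker than expert review).
Sequel of `FrobeniusClosingSteerSteeredMembersRegular.lean` (the content: local blowings up of regular
local rings along centres with regular quotient are regular, `isRegularLocalRing_steps`) and of
`FrobeniusClosingSteerEmptyStallTwo.lean` (`EmptyStallTwo.false_of_isSingPrime_two`): here the planner's
pieces M and B₂ of `L/w41/R2TwoSigma-r19.snippet.lean` (res-L0-w41-plan-1, sha16 ab3ec70bee111df3, §σ2.2)
are stated with EVERY binder of the skeleton's `CoreDatum` and with the sketch's run vocabulary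
(`IsSingPrime`, `IsTopSingComponent`, `IsPermissibleCentre`, `IsSigmaTopCentre`, `IsExcParamAlong`,
`IsStrictStepAlong`, `IsSteeredRunUpTo`, `SteeredStallAt`; `ZeroDim`, `Discrete`, `DenseAbhyankar`,
`IsFracOf`, `StronglySwitching`, `ArchSeq`, `Defect` inside the core datum) UNFOLDED verbatim — the
unfolded blocks are copied character-for-character from res-D-pv-012's landed literal piece E
(`FrobeniusClosingSteerCore4SteeredRunExistsLiteral.lean`, certified there against a verbatim replica
of the sketch), so that the holder's leaves are `SteeredMembersRegular.steeredMembersRegular` and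
`SteeredMembersRegular.emptyStallTwo` by `exact`. Only the regularity binder of the core datum and the
centre/blow-up clauses of the run are used. [cite: NovacoskiSpivakovsky2014, Def. 2.11] [folklore]
-/

set_option linter.dupNamespace false -- layout-mandated `Summit.<S>.<S>.…` (single-conjunct summit)

open IsLocalRing Literature.AlgebraicGeometry.Resolution

namespace Summit.ResolutionOfSingularities.ResolutionOfSingularities.Theorems.SwitchingDichotomy

namespace SteeredMembersRegular

/-! ## Piece M, literally -/

/-- **M · `SteeredMembersRegular`, the literal piece** of the σ_top composition at `p = 2`
(`L/w41/R2TwoSigma-r19.snippet.lean` ab3ec70bee111df3 §σ2.2, planner res-L0-w41-plan-1; generic `p`):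
from the core datum (all fourteen binders, verbatim), every member `R N` of a σ_top-steered run up to
stage `N` from `R 0 = (A₀)_{𝔪_O ∩ A₀}` is a REGULAR local ring — `R 0` is regular (core binder,
`isRegularLocalRing_locAtCentre_iff`), and each step is a local blowing up along a centre which is
either permissible (regular quotient) or the closed point (`isRegularLocalRing_steps`).
[cite: NovacoskiSpivakovsky2014, Def. 2.11] [cite: Liu2002, Thm. 8.1.19 (a)] [folklore] -/
theorem steeredMembersRegular :
    ∀ p : ℕ, p.Prime → ∀ n : ℕ, 4 ≤ n →
    ∀ (k K : Type) [Field k] [CharP k p] [PerfectField k] [Field K] [Algebra k K]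
    (O : ValuationSubring K) (A₀ : Subalgebra k K) (h₀ : A₀.toSubring ≤ O.toSubring) (t : K),
    (A₀.FG ∧ ∃ htp : t ^ p ∈ A₀, IsFractionRing (Algebra.adjoin k (insert t (A₀ : Set K))) K ∧
      IsRegularLocalRing (Localization.AtPrime
        (Ideal.comap (Subring.inclusion h₀) (IsLocalRing.maximalIdeal O))) ∧
      (Ideal.comap (Subring.inclusion h₀) (IsLocalRing.maximalIdeal O)).IsMaximal ∧
      (∀ x ∈ O, ∃ f : Polynomial k, f ≠ 0 ∧ Polynomial.aeval x f ∈ O.nonunits) ∧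
      ¬ ringKrullDim (Localization.AtPrime
        (Ideal.comap (Subring.inclusion h₀) (IsLocalRing.maximalIdeal O))) ≤ 2 ∧
      ¬ IsAbhyankarPlace O (algebraMap k K).fieldRange ⊤ ∧
      ¬ (∃ F₀ : Subfield K, (algebraMap k K).fieldRange ≤ F₀ ∧ FGOver (algebraMap k K).fieldRange F₀ ∧
          IsAbhyankarPlace O (algebraMap k K).fieldRange F₀ ∧
          ∀ x w : K, w ≠ 0 → ∃ a ∈ F₀, O.valuation (x - a) < O.valuation w) ∧
      ¬ (∃ π : K, π ≠ 0 ∧ O.valuation π < 1 ∧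
          ∀ z : K, z ≠ 0 → ∃ n : ℤ, O.valuation z = O.valuation π ^ n) ∧
      (∀ δ : Derivation ℤ (Localization.AtPrime (Ideal.comap (Subring.inclusion h₀)
          (IsLocalRing.maximalIdeal O))) (Localization.AtPrime (Ideal.comap (Subring.inclusion h₀)
          (IsLocalRing.maximalIdeal O))),
        ¬ IsUnit (δ (algebraMap A₀.toSubring (Localization.AtPrime (Ideal.comap (Subring.inclusion h₀)
          (IsLocalRing.maximalIdeal O))) ⟨t ^ p, htp⟩))) ∧
      (∀ c : Localization.AtPrime (Ideal.comap (Subring.inclusion h₀) (IsLocalRing.maximalIdeal O)),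
        algebraMap A₀.toSubring (Localization.AtPrime (Ideal.comap (Subring.inclusion h₀)
          (IsLocalRing.maximalIdeal O))) ⟨t ^ p, htp⟩ ≠ c ^ p) ∧
      Algebra.trdeg k K = (n : Cardinal) ∧
      ¬ ((∀ R : ℕ → Subring K, R 0 = locAtCentre A₀.toSubring O →
            (∀ i, IsQuadraticTransformAlong O (R i) (R (i + 1))) →
            ∀ x : K, x ∈ O → (∃ y ∈ A₀, ∃ z ∈ A₀, z ≠ 0 ∧ x = y / z) → ∃ i, x ∈ R i) ∧
         (∀ R : ℕ → Subring K, R 0 = locAtCentre A₀.toSubring O →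
            (∀ i, IsQuadraticTransformAlong O (R i) (R (i + 1))) →
            ∀ y : K, (∃ y' ∈ A₀, ∃ z ∈ A₀, z ≠ 0 ∧ y = y' / z) → y ≠ 0 → O.valuation y < 1 →
              ∃ (i : ℕ) (_ : IsLocalRing (R i)) (z : Fin 1 → R i), IsRsopPart z ∧
                ∃ n : ℕ, O.valuation ((z 0 : R i) : K) ^ n < O.valuation y) ∧
         ¬ (∀ g : K, (∃ y ∈ A₀, ∃ z ∈ A₀, z ≠ 0 ∧ g = y / z) →
            ∃ w : K, (∃ y ∈ A₀, ∃ z ∈ A₀, z ≠ 0 ∧ w = y / z) ∧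
              O.valuation (t ^ p - g ^ p) = O.valuation (w ^ p)))) →
    ∀ (R : ℕ → Subring K) (P : (i : ℕ) → Ideal (R i)) (s : ℕ → K) (N : ℕ),
      R 0 = locAtCentre A₀.toSubring O →
        (s 0 = t ∧ (∀ i ≤ N, s i ^ p ∈ R i) ∧ ∀ i < N, ∃ (_ : IsLocalRing (R i)) (hs : s i ^ p ∈ R i),
          ((P i ≠ maximalIdeal (R i) ∧
              (∃ _ : (P i).IsPrime,
                (¬ IsRegularLocalRing (AdjoinRoot (Polynomial.X ^ p - Polynomial.C
                  (algebraMap (R i) (Localization.AtPrime (P i)) ⟨s i ^ p, hs⟩)))) ∧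
                (∀ (Q : Ideal (R i)) [Q.IsPrime],
                  (¬ IsRegularLocalRing (AdjoinRoot (Polynomial.X ^ p - Polynomial.C
                    (algebraMap (R i) (Localization.AtPrime Q) ⟨s i ^ p, hs⟩)))) → Q ≤ P i → Q = P i) ∧
                (∀ (Q : Ideal (R i)) [Q.IsPrime],
                  (¬ IsRegularLocalRing (AdjoinRoot (Polynomial.X ^ p - Polynomial.C
                    (algebraMap (R i) (Localization.AtPrime Q) ⟨s i ^ p, hs⟩)))) →
                  (∀ (Q' : Ideal (R i)) [Q'.IsPrime],
                    (¬ IsRegularLocalRing (AdjoinRoot (Polynomial.X ^ p - Polynomial.C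
                      (algebraMap (R i) (Localization.AtPrime Q') ⟨s i ^ p, hs⟩)))) → Q' ≤ Q → Q' = Q) →
                  ringKrullDim (R i ⧸ Q) ≤ ringKrullDim (R i ⧸ P i))) ∧
              IsRegularLocalRing (R i ⧸ P i) ∧ ∃ g : R i, (⟨s i ^ p, hs⟩ : R i) - g ^ p ∈ P i ^ p) ∨
            (P i = maximalIdeal (R i) ∧
              (∀ Q : Ideal (R i), ¬ (Q ≠ maximalIdeal (R i) ∧
                (∃ _ : Q.IsPrime,
                  (¬ IsRegularLocalRing (AdjoinRoot (Polynomial.X ^ p - Polynomial.C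
                    (algebraMap (R i) (Localization.AtPrime Q) ⟨s i ^ p, hs⟩)))) ∧
                  (∀ (Q₁ : Ideal (R i)) [Q₁.IsPrime],
                    (¬ IsRegularLocalRing (AdjoinRoot (Polynomial.X ^ p - Polynomial.C
                      (algebraMap (R i) (Localization.AtPrime Q₁) ⟨s i ^ p, hs⟩)))) → Q₁ ≤ Q → Q₁ = Q) ∧
                  (∀ (Q₁ : Ideal (R i)) [Q₁.IsPrime],
                    (¬ IsRegularLocalRing (AdjoinRoot (Polynomial.X ^ p - Polynomial.C
                      (algebraMap (R i) (Localization.AtPrime Q₁) ⟨s i ^ p, hs⟩)))) →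
                    (∀ (Q' : Ideal (R i)) [Q'.IsPrime],
                      (¬ IsRegularLocalRing (AdjoinRoot (Polynomial.X ^ p - Polynomial.C
                        (algebraMap (R i) (Localization.AtPrime Q') ⟨s i ^ p, hs⟩)))) → Q' ≤ Q₁ → Q' = Q₁) →
                    ringKrullDim (R i ⧸ Q₁) ≤ ringKrullDim (R i ⧸ Q))) ∧
                IsRegularLocalRing (R i ⧸ Q) ∧ ∃ g : R i, (⟨s i ^ p, hs⟩ : R i) - g ^ p ∈ Q ^ p)) ∧
              ∃ g : R i, (⟨s i ^ p, hs⟩ : R i) - g ^ p ∈ maximalIdeal (R i) ^ p)) ∧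
          IsLocalBlowupAlong O (R i) (P i) (R (i + 1)) ∧
          ∃ x g : K, ((∃ hx : x ∈ R i, (⟨x, hx⟩ : R i) ∈ P i) ∧ x ≠ 0 ∧
            ∀ y : R i, y ∈ P i → O.valuation (y : K) ≤ O.valuation x) ∧ g ∈ R i ∧
            s i = x * s (i + 1) + g) →
      IsRegularLocalRing (R N) := by
  intro p _hp n _hn k K _ _ _ _ _ O A₀ h₀ t core R P s N hR0 hrun
  obtain ⟨-, -, -, hreg, -⟩ := core
  have h0 : IsRegularLocalRing (R 0) := by
    rw [hR0]
    exact (isRegularLocalRing_locAtCentre_iff h₀).mpr hreg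
  refine isRegularLocalRing_steps (O := O) R P N h0 (fun i hi => ?_) N le_rfl
  obtain ⟨hL, hs, hσ, hbl, -⟩ := hrun.2.2 i hi
  exact ⟨hL, hσ.elim (fun h => Or.inl h.2.2.1) (fun h => Or.inr h.1), hbl⟩

/-! ## Piece B₂, literally -/

/-- **B₂ · `EmptyStallTwo`, the literal piece** of the σ_top composition at `p = 2`
(`L/w41/R2TwoSigma-r19.snippet.lean` ab3ec70bee111df3 §σ2.2): at `p = 2` a σ_top-steered run from a
core datum NEVER STALLS — the member `R N` is regular (`steeredMembersRegular`) and over a regular member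
the stall clauses «torsor germ singular at the closed point» and «`∀ g, (s N)^p − g^p ∉ 𝔪^p = 𝔪²`» are
contradictory (`EmptyStallTwo.false_of_isSingPrime_two`, p499359). [folklore] -/
theorem emptyStallTwo :
    ∀ p : ℕ, p = 2 → ∀ n : ℕ, 4 ≤ n →
    ∀ (k K : Type) [Field k] [CharP k p] [PerfectField k] [Field K] [Algebra k K]
    (O : ValuationSubring K) (A₀ : Subalgebra k K) (h₀ : A₀.toSubring ≤ O.toSubring) (t : K),
    (A₀.FG ∧ ∃ htp : t ^ p ∈ A₀, IsFractionRing (Algebra.adjoin k (insert t (A₀ : Set K))) K ∧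
      IsRegularLocalRing (Localization.AtPrime
        (Ideal.comap (Subring.inclusion h₀) (IsLocalRing.maximalIdeal O))) ∧
      (Ideal.comap (Subring.inclusion h₀) (IsLocalRing.maximalIdeal O)).IsMaximal ∧
      (∀ x ∈ O, ∃ f : Polynomial k, f ≠ 0 ∧ Polynomial.aeval x f ∈ O.nonunits) ∧
      ¬ ringKrullDim (Localization.AtPrime
        (Ideal.comap (Subring.inclusion h₀) (IsLocalRing.maximalIdeal O))) ≤ 2 ∧
      ¬ IsAbhyankarPlace O (algebraMap k K).fieldRange ⊤ ∧
      ¬ (∃ F₀ : Subfield K, (algebraMap k K).fieldRange ≤ F₀ ∧ FGOver (algebraMap k K).fieldRange F₀ ∧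
          IsAbhyankarPlace O (algebraMap k K).fieldRange F₀ ∧
          ∀ x w : K, w ≠ 0 → ∃ a ∈ F₀, O.valuation (x - a) < O.valuation w) ∧
      ¬ (∃ π : K, π ≠ 0 ∧ O.valuation π < 1 ∧
          ∀ z : K, z ≠ 0 → ∃ n : ℤ, O.valuation z = O.valuation π ^ n) ∧
      (∀ δ : Derivation ℤ (Localization.AtPrime (Ideal.comap (Subring.inclusion h₀)
          (IsLocalRing.maximalIdeal O))) (Localization.AtPrime (Ideal.comap (Subring.inclusion h₀)
          (IsLocalRing.maximalIdeal O))),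
        ¬ IsUnit (δ (algebraMap A₀.toSubring (Localization.AtPrime (Ideal.comap (Subring.inclusion h₀)
          (IsLocalRing.maximalIdeal O))) ⟨t ^ p, htp⟩))) ∧
      (∀ c : Localization.AtPrime (Ideal.comap (Subring.inclusion h₀) (IsLocalRing.maximalIdeal O)),
        algebraMap A₀.toSubring (Localization.AtPrime (Ideal.comap (Subring.inclusion h₀)
          (IsLocalRing.maximalIdeal O))) ⟨t ^ p, htp⟩ ≠ c ^ p) ∧
      Algebra.trdeg k K = (n : Cardinal) ∧
      ¬ ((∀ R : ℕ → Subring K, R 0 = locAtCentre A₀.toSubring O →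
            (∀ i, IsQuadraticTransformAlong O (R i) (R (i + 1))) →
            ∀ x : K, x ∈ O → (∃ y ∈ A₀, ∃ z ∈ A₀, z ≠ 0 ∧ x = y / z) → ∃ i, x ∈ R i) ∧
         (∀ R : ℕ → Subring K, R 0 = locAtCentre A₀.toSubring O →
            (∀ i, IsQuadraticTransformAlong O (R i) (R (i + 1))) →
            ∀ y : K, (∃ y' ∈ A₀, ∃ z ∈ A₀, z ≠ 0 ∧ y = y' / z) → y ≠ 0 → O.valuation y < 1 →
              ∃ (i : ℕ) (_ : IsLocalRing (R i)) (z : Fin 1 → R i), IsRsopPart z ∧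
                ∃ n : ℕ, O.valuation ((z 0 : R i) : K) ^ n < O.valuation y) ∧
         ¬ (∀ g : K, (∃ y ∈ A₀, ∃ z ∈ A₀, z ≠ 0 ∧ g = y / z) →
            ∃ w : K, (∃ y ∈ A₀, ∃ z ∈ A₀, z ≠ 0 ∧ w = y / z) ∧
              O.valuation (t ^ p - g ^ p) = O.valuation (w ^ p)))) →
    ∀ (R : ℕ → Subring K) (P : (i : ℕ) → Ideal (R i)) (s : ℕ → K) (N : ℕ),
      R 0 = locAtCentre A₀.toSubring O →
        (s 0 = t ∧ (∀ i ≤ N, s i ^ p ∈ R i) ∧ ∀ i < N, ∃ (_ : IsLocalRing (R i)) (hs : s i ^ p ∈ R i),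
          ((P i ≠ maximalIdeal (R i) ∧
              (∃ _ : (P i).IsPrime,
                (¬ IsRegularLocalRing (AdjoinRoot (Polynomial.X ^ p - Polynomial.C
                  (algebraMap (R i) (Localization.AtPrime (P i)) ⟨s i ^ p, hs⟩)))) ∧
                (∀ (Q : Ideal (R i)) [Q.IsPrime],
                  (¬ IsRegularLocalRing (AdjoinRoot (Polynomial.X ^ p - Polynomial.C
                    (algebraMap (R i) (Localization.AtPrime Q) ⟨s i ^ p, hs⟩)))) → Q ≤ P i → Q = P i) ∧
                (∀ (Q : Ideal (R i)) [Q.IsPrime],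
                  (¬ IsRegularLocalRing (AdjoinRoot (Polynomial.X ^ p - Polynomial.C
                    (algebraMap (R i) (Localization.AtPrime Q) ⟨s i ^ p, hs⟩)))) →
                  (∀ (Q' : Ideal (R i)) [Q'.IsPrime],
                    (¬ IsRegularLocalRing (AdjoinRoot (Polynomial.X ^ p - Polynomial.C
                      (algebraMap (R i) (Localization.AtPrime Q') ⟨s i ^ p, hs⟩)))) → Q' ≤ Q → Q' = Q) →
                  ringKrullDim (R i ⧸ Q) ≤ ringKrullDim (R i ⧸ P i))) ∧
              IsRegularLocalRing (R i ⧸ P i) ∧ ∃ g : R i, (⟨s i ^ p, hs⟩ : R i) - g ^ p ∈ P i ^ p) ∨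
            (P i = maximalIdeal (R i) ∧
              (∀ Q : Ideal (R i), ¬ (Q ≠ maximalIdeal (R i) ∧
                (∃ _ : Q.IsPrime,
                  (¬ IsRegularLocalRing (AdjoinRoot (Polynomial.X ^ p - Polynomial.C
                    (algebraMap (R i) (Localization.AtPrime Q) ⟨s i ^ p, hs⟩)))) ∧
                  (∀ (Q₁ : Ideal (R i)) [Q₁.IsPrime],
                    (¬ IsRegularLocalRing (AdjoinRoot (Polynomial.X ^ p - Polynomial.C
                      (algebraMap (R i) (Localization.AtPrime Q₁) ⟨s i ^ p, hs⟩)))) → Q₁ ≤ Q → Q₁ = Q) ∧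
                  (∀ (Q₁ : Ideal (R i)) [Q₁.IsPrime],
                    (¬ IsRegularLocalRing (AdjoinRoot (Polynomial.X ^ p - Polynomial.C
                      (algebraMap (R i) (Localization.AtPrime Q₁) ⟨s i ^ p, hs⟩)))) →
                    (∀ (Q' : Ideal (R i)) [Q'.IsPrime],
                      (¬ IsRegularLocalRing (AdjoinRoot (Polynomial.X ^ p - Polynomial.C
                        (algebraMap (R i) (Localization.AtPrime Q') ⟨s i ^ p, hs⟩)))) → Q' ≤ Q₁ → Q' = Q₁) →
                    ringKrullDim (R i ⧸ Q₁) ≤ ringKrullDim (R i ⧸ Q))) ∧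
                IsRegularLocalRing (R i ⧸ Q) ∧ ∃ g : R i, (⟨s i ^ p, hs⟩ : R i) - g ^ p ∈ Q ^ p)) ∧
              ∃ g : R i, (⟨s i ^ p, hs⟩ : R i) - g ^ p ∈ maximalIdeal (R i) ^ p)) ∧
          IsLocalBlowupAlong O (R i) (P i) (R (i + 1)) ∧
          ∃ x g : K, ((∃ hx : x ∈ R i, (⟨x, hx⟩ : R i) ∈ P i) ∧ x ≠ 0 ∧
            ∀ y : R i, y ∈ P i → O.valuation (y : K) ≤ O.valuation x) ∧ g ∈ R i ∧
            s i = x * s (i + 1) + g) →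
          (∃ (_ : IsLocalRing (R N)) (hs : s N ^ p ∈ R N),
            (¬ IsRegularLocalRing (AdjoinRoot (Polynomial.X ^ p - Polynomial.C
              (algebraMap (R N) (Localization.AtPrime (maximalIdeal (R N))) ⟨s N ^ p, hs⟩)))) ∧
            (∀ Q : Ideal (R N), ¬ (Q ≠ maximalIdeal (R N) ∧
              (∃ _ : Q.IsPrime,
                (¬ IsRegularLocalRing (AdjoinRoot (Polynomial.X ^ p - Polynomial.C
                  (algebraMap (R N) (Localization.AtPrime Q) ⟨s N ^ p, hs⟩)))) ∧
                (∀ (Q₁ : Ideal (R N)) [Q₁.IsPrime],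
                  (¬ IsRegularLocalRing (AdjoinRoot (Polynomial.X ^ p - Polynomial.C
                    (algebraMap (R N) (Localization.AtPrime Q₁) ⟨s N ^ p, hs⟩)))) → Q₁ ≤ Q → Q₁ = Q) ∧
                (∀ (Q₁ : Ideal (R N)) [Q₁.IsPrime],
                  (¬ IsRegularLocalRing (AdjoinRoot (Polynomial.X ^ p - Polynomial.C
                    (algebraMap (R N) (Localization.AtPrime Q₁) ⟨s N ^ p, hs⟩)))) →
                  (∀ (Q' : Ideal (R N)) [Q'.IsPrime],
                    (¬ IsRegularLocalRing (AdjoinRoot (Polynomial.X ^ p - Polynomial.C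
                      (algebraMap (R N) (Localization.AtPrime Q') ⟨s N ^ p, hs⟩)))) → Q' ≤ Q₁ → Q' = Q₁) →
                  ringKrullDim (R N ⧸ Q₁) ≤ ringKrullDim (R N ⧸ Q))) ∧
              IsRegularLocalRing (R N ⧸ Q) ∧ ∃ g : R N, (⟨s N ^ p, hs⟩ : R N) - g ^ p ∈ Q ^ p)) ∧
            ∀ g : R N, (⟨s N ^ p, hs⟩ : R N) - g ^ p ∉ maximalIdeal (R N) ^ p) → False := by
  intro p hp2 n hn k K _ _ _ _ _ O A₀ h₀ t core R P s N hR0 hrun hstall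
  have hp : p.Prime := hp2 ▸ Nat.prime_two
  haveI : CharP K p := charP_of_injective_algebraMap (algebraMap k K).injective p
  have hreg : IsRegularLocalRing (R N) :=
    steeredMembersRegular p hp n hn k K O A₀ h₀ t core R P s N hR0 hrun
  obtain ⟨_, hs, hsing, -, hmult⟩ := hstall
  exact EmptyStallTwo.false_of_isSingPrime_two p hp2 R s N hreg hs hsing hmult

end SteeredMembersRegular

end Summit.ResolutionOfSingularities.ResolutionOfSingularities.Theorems.SwitchingDichotomy
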